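import Literature.AnabelianGeometry.SemiGraphs.PSCSmoothProperOrigin
import Literature.AnabelianGeometry.SemiGraphs.PSCUnrVerticialOneVertex
import Literature.AnabelianGeometry.SemiGraphs.PSCRamificationSplitInjection
import Literature.AnabelianGeometry.SemiGraphs.PSCCoveringBranchData
import Literature.AnabelianGeometry.SemiGraphs.ProSigmaSurfaceFreeProlRank
import Literature.AnabelianGeometry.SemiGraphs.ProSigmaCompletionRestrict
import Literature.AnabelianGeometry.SemiGraphs.ProSigmaCompletionModels
import HarnessLib

/-!
# A covering-closed GENUINE origin of smooth proper curves for the [CombGC] §1 schemata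

Mochizuki, *A combinatorial version of the Grothendieck conjecture* [CombGC], Tohoku Math. J. **59**
(2007), §1 pp. 6–14: Def. 1.1 (i) "of pro-Σ PSC-type", (ii) "a finite étale covering of `G` that arises
from an open subgroup of `Π_G`" is again of PSC-type, Rmk. 1.1.5 p. 8 (ranks / Riemann–Hurwitz).
[cite: MochizukiCombGC2007, Def 1.1(ii) p.6] [cite: MochizukiCombGC2007, Rmk 1.1.5 p.8]

PROOF-ONLY file (abc-iut cell, layer L3, [CombGC] non-vacuity programme; seat abc-iut-w5-d195 gen 6,
support brick «SP-GENUINE-COVERING-CLOSED», the item "recommended next, not claimed" by abc-iut-f-165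
2026-08-26T10:13Z).  The printed statements of [CombGC] §1 are typed (abc-iut-L3-t4) as schemata
`…Holds Ω` over an origin parameter `Ω : PSCOrigin`; their joint satisfiability has so far been witnessed
at the SHAPE origin "all data of smooth-proper shape" (`exists_smoothProperOrigin_holds`), which is NOT
closed under the covering functor `restrictBD` in a way that remembers a genuine group, so that the
origin-level input `RestrictBDOfPSCTypeHolds Ω` (Def. 1.1 (ii), repaired form) had no genuine witness.
Here the GENUINE smooth-proper origin is used instead: data over a PROFINITE group `Π` with one vertex,
no nodes, no cusps, `Π_v = Π`, together with a pro-`Σ` completion `ι : S_g → Π` of the closed surface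
group of genus `g ≥ 2` (`SurfaceGroup g`, ZVC §3) with `genus(v) = g`.

* `restrict_smoothProperGenuine` — **covering-closedness**: for such a datum and every open subgroup
  `U ⊆ Π` of finite index, the covering datum `G_U = G.restrict U` is again of that kind: one vertex,
  no edges, `Π_w = U`, Riemann–Hurwitz genus `hurwitzGenus [Π:U] g 0 0 = [Π:U](g−1)+1`
  (`hurwitzGenus_smoothProper`), and `U` is the pro-`Σ` completion of `ι⁻¹(U) ≅ S_{[Π:U](g−1)+1}`
  (the tree's THEOREM `surfaceGroupFiniteIndexSubgroup_holds` = E-002 / ZVC 4.14.22, composed with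
  `IsProSigmaCompletion.restrict` and `index_comap_of_isOpen`);
* `exists_smoothProperGenuineOrigin_holds` — the origin `Ω` of genuine smooth-proper data is
  INHABITED (by `Ŝ₂`, the profinite completion of `S_2`, `Σ` = all primes) and at it
  **`RestrictBDOfPSCTypeHolds Ω`** holds together with F-0438 ∧ F-0459 ∧ F-0440 ∧ F-0443 ∧ F-0458 ∧
  F-0444 ∧ F-0461 ∧ F-1931 ∧ F-1937 ∧ F-1938′ (`UnrVerticialCharacterizationHolds'`) and profiniteness
  of every `Ω`-datum (abc-iut-L3-t4's smooth-proper instance forms BY NAME).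

The rank statement `UnrVertAbOfRankHolds Ω` at this origin (abelianisation of the completion =
completion of `S_g^{ab} ≅ ℤ^{2g}`) is the sequel (`ProSigmaCompletionQuotientTransfer.lean`).  Consistency
/ non-vacuity evidence for the typed family at genuine one-component data; not the printed theorems for
all pointed stable curves; nothing here takes a side on [IUTchIII] Cor. 3.12.
-/

noncomputable section

namespace Literature.AnabelianGeometry.SemiGraphs

namespace PSCDatum

open scoped Pointwise
open PSCCovering
open Literature.Topology.FourManifolds (SurfaceGroup)
open Literature.GroupTheory.CombinatorialGroupTheory (surfaceGroupFiniteIndexSubgroup_holds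
  two_le_genus_of_index)
open SemiGraphOfAnabelioids (IsProSigmaCompletion)
open Literature.IUT.HodgeTheaters (profiniteCompletion toCompletion)

universe u

variable {P : Type u} [Group P] [TopologicalSpace P]

/-! ### Arithmetic: the Riemann–Hurwitz genus of an unramified cover of a smooth proper curve -/

omit [TopologicalSpace P] in
/-- `hurwitzGenus d g 0 0 = d (g − 1) + 1` for `g ≥ 1` (unramified degree-`d` cover of a genus-`g`
curve; ZVC 4.14.22's genus). [cite: MochizukiCombGC2007, Rmk 1.1.5 p.8] -/
theorem hurwitzGenus_smoothProper (d g : ℕ) (hg : 1 ≤ g) :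
    hurwitzGenus d g 0 0 = d * (g - 1) + 1 := by
  unfold hurwitzGenus
  have h2 : (d : ℤ) * (2 * (g : ℤ) - 2 + ((0 : ℕ) : ℤ)) - ((0 : ℕ) : ℤ) = 2 * ((d : ℤ) * ((g : ℤ) - 1)) := by
    push_cast; ring
  rw [h2, Int.mul_ediv_cancel_left _ (two_ne_zero)]
  have hg' : ((g : ℤ) - 1) = ((g - 1 : ℕ) : ℤ) := by rw [Nat.cast_sub hg, Nat.cast_one]
  rw [hg', show (1 : ℤ) + (d : ℤ) * ((g - 1 : ℕ) : ℤ) = ((d * (g - 1) + 1 : ℕ) : ℤ) by push_cast; ring,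
    Int.toNat_natCast]

/-! ### Smooth-proper shape: no branches, one double coset, full vertex groups -/

omit [TopologicalSpace P] in
/-- With no nodes and no cusps every branch count vanishes. [cite: MochizukiCombGC2007, Def 1.1(i) p.6] -/
theorem branchCount_eq_zero_of_isEmpty (𝔾 : PSCSemiGraph) [IsEmpty 𝔾.N] [IsEmpty 𝔾.C] (v : 𝔾.V) :
    𝔾.branchCount v = 0 := by
  simp [PSCSemiGraph.branchCount, Finset.univ_eq_empty]

omit [TopologicalSpace P] in
/-- A conjugate of `⊤` is `⊤`. [folklore] -/
private theorem conjAct_smul_top' (γ : ConjAct P) : γ • (⊤ : Subgroup P) = ⊤ :=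
  top_le_iff.mp fun x _ => by rw [Subgroup.mem_pointwise_smul_iff_inv_smul_mem]; exact Subgroup.mem_top _

omit [TopologicalSpace P] in
/-- `U \ Π / Π` is a single double coset. [cite: MochizukiCombGC2007, Def 1.1(ii) p.6] -/
theorem natCard_doubleCosetQuotient_top (U : Subgroup P) :
    Nat.card (DoubleCoset.Quotient (U : Set P) ((⊤ : Subgroup P) : Set P)) = 1 := by
  haveI : Subsingleton (DoubleCoset.Quotient (U : Set P) ((⊤ : Subgroup P) : Set P)) := ⟨by
    intro a b
    induction a using Quotient.inductionOn with
    | h x =>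
      induction b using Quotient.inductionOn with
      | h y =>
        change DoubleCoset.mk U ⊤ x = DoubleCoset.mk U ⊤ y
        rw [DoubleCoset.eq]
        exact ⟨1, U.one_mem, x⁻¹ * y, Subgroup.mem_top _, by group⟩⟩
  haveI : Nonempty (DoubleCoset.Quotient (U : Set P) ((⊤ : Subgroup P) : Set P)) :=
    ⟨DoubleCoset.mk U ⊤ 1⟩
  exact Nat.card_unique

section Restrict

variable (G : PSCDatum P) (U : Subgroup P) [U.FiniteIndex]

/-- No nodes upstairs. [cite: MochizukiCombGC2007, Def 1.1(ii) p.6] -/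
theorem isEmpty_restrictGraph_N [IsEmpty G.graph.N] : IsEmpty (G.restrictGraph U).N := by
  change IsEmpty (Σ e : G.graph.N, dcFin U (G.nodeGp e)); infer_instance

/-- No cusps upstairs. [cite: MochizukiCombGC2007, Def 1.1(ii) p.6] -/
theorem isEmpty_restrictGraph_C [IsEmpty G.graph.C] : IsEmpty (G.restrictGraph U).C := by
  change IsEmpty (Σ c : G.graph.C, dcFin U (G.cuspGp c)); infer_instance

/-- One vertex upstairs over one vertex with `Π_v = Π`: `U \ Π / Π` is a point.
[cite: MochizukiCombGC2007, Def 1.1(ii) p.6] -/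
theorem exists_forall_eq_restrictGraph_V (hV : ∀ v, G.vertGp v = ⊤) (v₀ : G.graph.V)
    (hv : ∀ w, w = v₀) : ∃ w₀ : (G.restrictGraph U).V, ∀ w, w = w₀ := by
  have hsub : ∀ v : G.graph.V, Subsingleton (dcFin U (G.vertGp v)) := fun v => by
    rw [Fin.subsingleton_iff_le_one, hV v, natCard_doubleCosetQuotient_top]
  refine ⟨⟨v₀, dcIdx U (G.vertGp v₀) 1⟩, ?_⟩
  rintro ⟨v, i⟩
  obtain rfl := hv v
  exact Sigma.ext rfl (heq_of_eq (Subsingleton.elim _ _))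

variable [IsTopologicalGroup P]

/-- `Π_w = U` for every vertex `w` of `G_U` when `Π_v = Π`. [cite: MochizukiCombGC2007, Def 1.1(ii) p.6] -/
theorem restrict_vertGp_eq_top (hU : IsOpen (U : Set P)) (hV : ∀ v, G.vertGp v = ⊤)
    (w : (G.restrictGraph U).V) :
    (G.restrict U hU).vertGp w = ⊤ := by
  rw [restrict_vertGp, hV, conjAct_smul_top', Subgroup.top_subgroupOf]

omit [IsTopologicalGroup P] in
/-- The local degree at the unique vertex is the global degree `[Π : U]` when `Π_v = Π`.
[cite: MochizukiCombGC2007, Def 1.1(ii) p.6] -/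
theorem localDegree_eq_index (hV : ∀ v, G.vertGp v = ⊤) (w : (G.restrictGraph U).V) :
    G.localDegree U w = U.index := by
  rw [localDegree, hV, conjAct_smul_top', Subgroup.relIndex_top_right]

/-- **Riemann–Hurwitz at smooth-proper shape**: the genus of the (unique) vertex of `G_U` is
`[Π : U] (g − 1) + 1`. [cite: MochizukiCombGC2007, Rmk 1.1.5 p.8] -/
theorem restrict_genus_smoothProper (hU : IsOpen (U : Set P)) [IsEmpty G.graph.N] [IsEmpty G.graph.C]
    (hV : ∀ v, G.vertGp v = ⊤) {g : ℕ} (hg : 1 ≤ g) (hgen : ∀ v, G.genus v = g)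
    (w : (G.restrictGraph U).V) :
    (G.restrict U hU).genus w = U.index * (g - 1) + 1 := by
  haveI := G.isEmpty_restrictGraph_N U
  haveI := G.isEmpty_restrictGraph_C U
  change G.restrictGenus U w = _
  rw [restrictGenus, G.localDegree_eq_index U hV, hgen, branchCount_eq_zero_of_isEmpty,
    branchCount_eq_zero_of_isEmpty, hurwitzGenus_smoothProper _ _ hg]

omit [U.FiniteIndex] in
/-- **The open subgroup `U` is the pro-`Σ` completion of a surface group of the Riemann–Hurwitz
genus**: if `ι : S_g → Π` (`g ≥ 2`) is a pro-`Σ` completion of the profinite `Π` and `U ⊆ Π` is open,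
then `ι⁻¹(U) ≅ S_{[Π:U](g−1)+1}` (E-002 / ZVC 4.14.22, the tree's theorem
`surfaceGroupFiniteIndexSubgroup_holds`, with `[S_g : ι⁻¹U] = [Π : U]`) and `ι|` exhibits `U` as its
pro-`Σ` completion. [cite: ZieschangVogtColdewey1980, Prop 4.14.22 p.154] -/
theorem exists_isProSigmaCompletion_restrict_surfaceGroup [CompactSpace P] [TotallyDisconnectedSpace P]
    (hU : IsOpen (U : Set P)) {Sigma : Set ℕ} {g : ℕ} (hg : 2 ≤ g) (ι : SurfaceGroup g →* P)
    (hι : IsProSigmaCompletion Sigma ι) :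
    ∃ ι' : SurfaceGroup (U.index * (g - 1) + 1) →* U, IsProSigmaCompletion Sigma ι' := by
  haveI : (U.comap ι).FiniteIndex := IsProSigmaCompletion.finiteIndex_comap hι U hU
  obtain ⟨h, hh, ⟨e⟩⟩ := surfaceGroupFiniteIndexSubgroup_holds g hg (U.comap ι) inferInstance
  rw [IsProSigmaCompletion.index_comap_of_isOpen hι U hU] at hh
  subst hh
  refine ⟨(ι.subgroupComap U).comp e.symm.toMonoidHom, ?_⟩
  exact IsProSigmaCompletion.of_comp_mulEquiv e.symm (fun _ => rfl)
    (IsProSigmaCompletion.restrict hι U hU)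

/-- **Covering-closedness of the genuine smooth-proper origin.**  If `G` is a datum over a profinite
`Π` with no nodes, no cusps, one vertex with `Π_v = Π`, a pro-`Σ` completion `ι : S_g → Π` (`g ≥ 2`)
and `genus(v) = g`, then for every open subgroup `U ⊆ Π` of finite index the covering datum
`G_U = G.restrict U` (Def. 1.1 (ii)) is of the same kind, with genus `[Π:U](g−1)+1 ≥ 2`.
[cite: MochizukiCombGC2007, Def 1.1(ii) p.6] -/
theorem restrict_smoothProperGenuine [CompactSpace P] [TotallyDisconnectedSpace P]
    (hU : IsOpen (U : Set P)) [IsEmpty G.graph.N] [IsEmpty G.graph.C] (hV : ∀ v, G.vertGp v = ⊤)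
    (v₀ : G.graph.V)
    (hv : ∀ w, w = v₀) {g : ℕ} (hg : 2 ≤ g) (ι : SurfaceGroup g →* P)
    (hι : IsProSigmaCompletion G.Sigma ι) (hgen : ∀ v, G.genus v = g) :
    IsEmpty (G.restrict U hU).graph.N ∧ IsEmpty (G.restrict U hU).graph.C ∧
      (∀ w, (G.restrict U hU).vertGp w = ⊤) ∧ (∃ w₀ : (G.restrict U hU).graph.V, ∀ w, w = w₀) ∧
      ∃ (g' : ℕ) (ι' : SurfaceGroup g' →* U), 2 ≤ g' ∧ IsProSigmaCompletion (G.restrict U hU).Sigma ι' ∧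
        ∀ w, (G.restrict U hU).genus w = g' := by
  obtain ⟨ι', hι'⟩ := exists_isProSigmaCompletion_restrict_surfaceGroup U hU hg ι hι
  haveI : U.FiniteIndex := inferInstance
  have hidx : U.index ≠ 0 := Subgroup.FiniteIndex.index_ne_zero
  refine ⟨G.isEmpty_restrictGraph_N U, G.isEmpty_restrictGraph_C U, G.restrict_vertGp_eq_top U hU hV,
    G.exists_forall_eq_restrictGraph_V U hV v₀ hv, U.index * (g - 1) + 1, ι',
    two_le_genus_of_index hg hidx rfl, hι', fun w => ?_⟩
  exact G.restrict_genus_smoothProper U hU hV (le_trans one_le_two hg) hgen w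

end Restrict

/-! ### The genuine smooth-proper origin: inhabited, covering-closed, and the §1 schemata hold -/

/-- **The GENUINE smooth-proper origin is inhabited and covering-closed, and the [CombGC] §1 / [IUTchI]
Rmk. 1.2.3 schemata hold at it.**  Let `Ω` declare "of PSC-type" exactly the data over a PROFINITE group
with no nodes, no cusps, one vertex with `Π_v = Π`, and a pro-`Σ` completion `ι : S_g → Π` (`g ≥ 2`,
`Σ = G.Sigma`) with `genus(v) = g`.  Then `Ω` contains `Ŝ₂` (the profinite completion of `S_2`, `Σ` =
all primes); **`RestrictBDOfPSCTypeHolds Ω`** (Def. 1.1 (ii): finite étale coverings of `Ω`-data are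
`Ω`-data — `restrict_smoothProperGenuine`); every `Ω`-datum is profinite; and F-0438 (Prop 1.2 (ii)),
F-0459 (Prop 1.2 (i)), F-0440 (Prop 1.5 (i)), F-0443 (Prop 1.5 (ii)), F-0458 (Thm 1.6 (i)), F-0444
(Thm 1.6 (ii)), F-0461 (Thm 1.6 (iii)), F-1931 / F-1937 (Rmk 1.2.3 (iv) cusp / (v)) and the corrected
F-1938′ (`UnrVerticialCharacterizationHolds'`) hold at `Ω` (abc-iut-L3-t4's smooth-proper instance forms).
Consistency / non-vacuity evidence at genuine one-component data, not the printed theorems.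
[cite: MochizukiCombGC2007, Def 1.1(ii) p.6] -/
theorem exists_smoothProperGenuineOrigin_holds :
    ∃ Ω : PSCOrigin.{0},
      (∃ G : PSCDatum (profiniteCompletion (SurfaceGroup 2)),
        Ω.IsOfPSCType G ∧ G.IsSturdy ∧ G.Sigma = {p | p.Prime} ∧ G.graph.i = 1 ∧ G.graph.n = 0 ∧
          G.graph.r = 0 ∧ (∀ v, G.vertGp v = ⊤ ∧ G.genus v = 2) ∧
          IsProSigmaCompletion G.Sigma (toCompletion (SurfaceGroup 2))) ∧
      RestrictBDOfPSCTypeHolds Ω ∧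
      (∀ ⦃Q : Type⦄ [Group Q] [TopologicalSpace Q] [IsTopologicalGroup Q] (G : PSCDatum Q),
        Ω.IsOfPSCType G → CompactSpace Q ∧ T2Space Q ∧ TotallyDisconnectedSpace Q) ∧
      CommensurableTerminalityHolds Ω ∧ OpenInterDeterminesComponentHolds Ω ∧
      EdgeLikeIncidenceHolds Ω ∧ GraphicIffEdgeLikeVerticialHolds Ω ∧ NumericallyCuspidalIffHolds Ω ∧
      GraphicIffFiltrationPreservingHolds Ω ∧ UnrVerticialIffHolds Ω ∧
      CuspidalEdgeLikeCharacterizationHolds Ω ∧ NodalEdgeLikeCharacterizationHolds Ω ∧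
      UnrVerticialCharacterizationHolds' Ω := by
  let Ω : PSCOrigin.{0} :=
    ⟨fun {Q} _ _ G => ∃ (_ : IsTopologicalGroup Q), CompactSpace Q ∧ T2Space Q ∧
      TotallyDisconnectedSpace Q ∧ IsEmpty G.graph.N ∧ IsEmpty G.graph.C ∧ (∀ v, G.vertGp v = ⊤) ∧
      (∃ v₀ : G.graph.V, ∀ w, w = v₀) ∧
      ∃ (g : ℕ) (ι : SurfaceGroup g →* Q), 2 ≤ g ∧ IsProSigmaCompletion G.Sigma ι ∧ ∀ v, G.genus v = g⟩
  -- the shape hypotheses of abc-iut-L3-t4's instance forms, read off `Ω`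
  have hΩ : ∀ ⦃Q : Type⦄ [Group Q] [TopologicalSpace Q] (G : PSCDatum Q), Ω.IsOfPSCType G →
      IsEmpty G.graph.N ∧ IsEmpty G.graph.C ∧ (∀ v, G.vertGp v = ⊤) ∧ ∃ v₀ : G.graph.V, ∀ w, w = v₀ := by
    intro Q _ _ G hG
    obtain ⟨_, -, -, -, hN, hC, hV, hv, -⟩ := hG
    exact ⟨hN, hC, hV, hv⟩
  -- the genuine datum `Ŝ₂`
  let G : PSCDatum (profiniteCompletion (SurfaceGroup 2)) :=
    { Sigma := {p | p.Prime}
      sigma_prime := fun _ hp => hp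
      sigma_nonempty := ⟨2, Nat.prime_two⟩
      graph := { V := Unit, N := Empty, C := Empty, nodeEnds := Empty.elim, cuspEnd := Empty.elim }
      vertGp := fun _ => ⊤
      nodeGp := Empty.elim
      cuspGp := Empty.elim
      genus := fun _ => 2
      isClosed_vertGp := fun _ => by rw [Subgroup.coe_top]; exact isClosed_univ
      isClosed_nodeGp := fun e => e.elim
      isClosed_cuspGp := fun c => c.elim
      nodeGp_le := fun e => e.elim
      cuspGp_le := fun c => c.elim
      proSigma := ⟨fun _ _ _ hp _ => hp⟩ }
  have hι : IsProSigmaCompletion G.Sigma (toCompletion (SurfaceGroup 2)) :=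
    IsProSigmaCompletion.isProSigmaCompletion_toCompletion (SurfaceGroup 2)
  have hG : Ω.IsOfPSCType G :=
    ⟨inferInstance, inferInstance, inferInstance, inferInstance, inferInstanceAs (IsEmpty Empty),
      inferInstanceAs (IsEmpty Empty), fun _ => rfl, ⟨(), fun _ => rfl⟩, 2, toCompletion (SurfaceGroup 2),
      le_rfl, hι, fun _ => rfl⟩
  refine ⟨Ω, ⟨G, hG, fun _ => le_rfl, rfl, rfl, rfl, rfl, fun _ => ⟨rfl, rfl⟩, hι⟩, ?_, ?_,
    commensurableTerminalityHolds_of_smoothProper Ω hΩ,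
    openInterDeterminesComponentHolds_of_smoothProper Ω hΩ, edgeLikeIncidenceHolds_of_smoothProper Ω hΩ,
    graphicIffEdgeLikeVerticialHolds_of_smoothProper Ω hΩ,
    numericallyCuspidalIffHolds_of_smoothProper Ω hΩ,
    graphicIffFiltrationPreservingHolds_of_smoothProper Ω hΩ, unrVerticialIffHolds_of_smoothProper Ω hΩ,
    cuspidalEdgeLikeCharacterizationHolds_of_smoothProper Ω hΩ,
    nodalEdgeLikeCharacterizationHolds_of_smoothProper Ω hΩ,
    unrVerticialCharacterizationHolds'_of_smoothProper Ω hΩ⟩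
  · -- RestrictBDOfPSCTypeHolds
    intro Q _ _ _ H hH
    obtain ⟨_, hc, ht, hd, hN, hC, hV, ⟨v₀, hv⟩, g, ι, hg, hιH, hgen⟩ := hH
    refine ⟨H.chosenBranchData, fun U _ hU => ?_⟩
    rw [restrictBD_chosen]
    haveI : CompactSpace U := isCompact_iff_compactSpace.mp (U.isClosed_of_isOpen hU).isCompact
    obtain ⟨hN', hC', hV', hv', g', ι', hg', hι', hgen'⟩ :=
      H.restrict_smoothProperGenuine U hU hV v₀ hv hg ι hιH hgen
    exact ⟨inferInstance, inferInstance, inferInstance, inferInstance, hN', hC', hV', hv', g', ι', hg', hι',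
      hgen'⟩
  · -- profiniteness of every `Ω`-datum
    intro Q _ _ _ H hH
    obtain ⟨_, hc, ht, hd, -⟩ := hH
    exact ⟨hc, ht, hd⟩

end PSCDatum

end Literature.AnabelianGeometry.SemiGraphs

end
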